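import Summits.ResolutionOfSingularities.ResolutionOfSingularities.Theorems.FrobeniusClosingClosingReductionUnwinding
import Summits.ResolutionOfSingularities.ResolutionOfSingularities.Theorems.FrobeniusClosingClosingReductionDeterminacy
import Summits.ResolutionOfSingularities.ResolutionOfSingularities.Theorems.FrobeniusClosingClosingReductionPairIsoKit
import Summits.ResolutionOfSingularities.ResolutionOfSingularities.Theorems.FrobeniusClosingClosingReductionLoewyKit
import Summits.ResolutionOfSingularities.ResolutionOfSingularities.Theorems.FrobeniusClosingClosingReductionTransport
import Summits.ResolutionOfSingularities.ResolutionOfSingularities.Theorems.FrobeniusClosingClosingReductionArena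
import Summits.ResolutionOfSingularities.ResolutionOfSingularities.Theorems.FrobeniusClosingClosingReductionThm21BGM
import Summits.ResolutionOfSingularities.ResolutionOfSingularities.Theorems.ClosingReduction.Negative.DimensionOne

/-!
# Crux `ClosingReduction` (stmt-ResolutionOfSingularities-16347) — line `chart-factorization`: THE ASSEMBLY

Route `ResolutionOfSingularities/FrobeniusClosing`, crux #5:
`ClosingReduction := NoPeriodicIsolatedAtom → BoundedMilnor → IsolatedForcedTermination`.

This file composes the landed stubs of the line (`stub_pairIsoKit`, `stub_transport`, `stub_determinacy`,
`stub_loewyKit`, `stub_arena`, `stub_unwinding`, `stub_thm21BGM`; first lemma `stub_factorization`) exactly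
as the registered skeleton `Cruxes/ClosingReduction/Lines/chart_factorization.lean` does
(`ClosingReduction_of`, hypotheses = the stub statements as Props of `Theorems/FrobeniusClosingDefs.lean`
plus the two external statements), and proves the crux CONDITIONALLY on the one statement it consumes by
name that is not this crux's to prove: the route's SUPPORT ITEM `ClosingLemma`
(stmt-ResolutionOfSingularities-16348, the closing lemma of arithmetic dynamics / twisted Lang–Weil):
`ClosingReduction_proof (hCL : ClosingLemma) : ClosingReduction`. The other external input,
Boubakri–Greuel–Markwig Thm 2.1 (finite determinacy), is the vendored fact
`Literature.AlgebraicGeometry.Resolution.BoubakriGreuelMarkwig.Thm21`, DISCHARGED in the tree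
(`Thm21_holds`) and entering through the landed stub `stub_thm21BGM`.

Dimension `n = 1` is the landed `Negative.isolatedForcedTermination_dim_one`; for `n ≥ 2`: bounded `μ`
gives the Loewy bound `𝔪^β ≤ jac` along the run (`LoewyKit` (1)); ENCODE (`ArenaE`) makes the run an
infinite path of the Diophantine arena over `κ`; `ClosingLemma` gives a periodic path over a finite field
`F`; pushed into `F̄` (`Edge.map`) and DECODED it is a returning chain of bounded successor pairs;
`Unwinding` realises it as an honest run over `F̄` returning to a pair-isomorphic state, which
`NoPeriodicIsolatedAtom` forbids.
-/

noncomputable section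

-- single-problem summit: the doubled namespace component `ResolutionOfSingularities` is forced
set_option linter.dupNamespace false

open scoped BigOperators Classical

open Summit.ResolutionOfSingularities.ResolutionOfSingularities.Theses.FrobeniusClosing
  (ClosingReduction NoPeriodicIsolatedAtom BoundedMilnor IsolatedForcedTermination ClosingLemma)
open Literature.AlgebraicGeometry.Resolution (BoubakriGreuelMarkwig.Thm21)

namespace Summit.ResolutionOfSingularities.ResolutionOfSingularities.Theorems.FrobeniusClosing

/-- `T`-edges are preserved under an extension `F ⊆ L` of `ℤ/p`-fields (the polynomials have
coefficients in `ℤ/p`; `F → L` is injective). Pushes `ClosingLemma`'s periodic path over a finite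
field `F` into `F̄`. [folklore] -/
theorem Edge.map_algebraMap {p N k : ℕ} (P Q : Fin k → Finset (MvPolynomial (Fin N ⊕ Fin N) (ZMod p)))
    {F L : Type} [Field F] [Algebra (ZMod p) F] [Field L] [Algebra (ZMod p) L] [Algebra F L]
    [IsScalarTower (ZMod p) F L] {x y : Fin N → F} (h : Edge p P Q F x y) :
    Edge p P Q L (algebraMap F L ∘ x) (algebraMap F L ∘ y) := by
  obtain ⟨j, hP, g, hg, hg0⟩ := h
  have key : ∀ f : MvPolynomial (Fin N ⊕ Fin N) (ZMod p),
      MvPolynomial.aeval (Sum.elim (algebraMap F L ∘ x) (algebraMap F L ∘ y)) f =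
        algebraMap F L (MvPolynomial.aeval (Sum.elim x y) f) := fun f => by
    rw [← Sum.comp_elim, MvPolynomial.aeval_algebraMap_apply]
  refine ⟨j, fun f hf => ?_, g, hg, ?_⟩
  · rw [key, hP f hf, map_zero]
  · rw [key]
    intro h0
    exact hg0 ((algebraMap F L).injective (by rw [h0, map_zero]))

/-- **`ClosingReduction` from the stub statements, BGM Thm 2.1 and the closing lemma** (the registered
skeleton's composition, over the landed vocabulary). Dimension `n = 1`: the conclusion holds outright
(`Negative.isolatedForcedTermination_dim_one`). Dimension `n ≥ 2`: bounded `μ` gives the Loewy bound along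
the run; ENCODE makes the run an infinite path of the Diophantine arena; the closing lemma gives a
periodic path over a finite field; pushed into its algebraic closure and DECODED it is a returning chain
of bounded successor pairs; UNWINDING realises it as an honest returning run, which the certificate
forbids. [cite: Varshavsky2014, Thm. 0.1; BoubakriGreuelMarkwig2010, Thm. 2.1] -/
theorem ClosingReduction_of (hK : PairIsoKit) (hT : PairIsoKit → Transport)
    (hD : BoubakriGreuelMarkwig.Thm21 → PairDeterminacy) (hL : LoewyKit)
    (hA : PairDeterminacy → PairIsoKit → Transport → LoewyKit → ArenaE)
    (hU : PairIsoKit → Transport → LoewyKit → Unwinding) (h21 : BoubakriGreuelMarkwig.Thm21)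
    (hCL : ClosingLemma) : ClosingReduction := by
  intro hNP hB
  rw [isolatedForcedTermination_iff]
  intro p hp n hn κ _ _ _ c₀ i t hrun
  -- dimension one: the conclusion holds outright
  rcases Nat.lt_or_ge n 2 with hn2 | hn2
  · obtain rfl : n = 1 := by omega
    exact Theorems.ClosingReduction.Negative.isolatedForcedTermination_dim_one p hp κ c₀ i t hrun
  -- dimension ≥ 2: the closing argument
  obtain ⟨β, hβ⟩ := boundedMilnor_iff.1 hB p hp n hn κ c₀ i t hrun
  have hKit : PairIsoKit := hK
  have hTr : Transport := hT hKit
  have hLo : LoewyKit := hL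
  have hDet : PairDeterminacy := hD h21
  obtain ⟨N, M, k, e, P, Q, henc, hdec⟩ := hA hDet hKit hTr hLo p hp n hn2 β
  letI : Algebra (ZMod p) κ := ZMod.algebra κ p
  have hJ : ∀ m, JacPow p n κ β (run p n κ c₀ i t m) :=
    fun m => hLo.1 p n κ _ β (hrun m).1 (hβ m)
  -- ENCODE every honest step of the run (`run (m+1)` is `step (i m) (t m) (run m)` by `rfl`)
  have hw : ∀ m, ∃ w : Fin M → κ, ∀ w' : Fin M → κ,
      Edge p P Q κ (Fin.append (code p n κ e (run p n κ c₀ i t m)) w)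
        (Fin.append (code p n κ e (run p n κ c₀ i t (m + 1))) w') :=
    fun m => henc κ (run p n κ c₀ i t m) (i m) (t m) (hJ m) (hrun m).2 (hJ (m + 1)) (hrun (m + 1)).2
  choose w hw using hw
  have path : ∀ m, Edge p P Q κ (Fin.append (code p n κ e (run p n κ c₀ i t m)) (w m))
      (Fin.append (code p n κ e (run p n κ c₀ i t (m + 1))) (w (m + 1))) :=
    fun m => hw m (w (m + 1))
  obtain ⟨F, instF, instA, instFin, wF, r, hr, hper, hwF⟩ :=
    hCL p hp (N + M) k P Q
      ⟨κ, inferInstance, inferInstance,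
        fun m => Fin.append (code p n κ e (run p n κ c₀ i t m)) (w m), path⟩
  haveI : Fact p.Prime := ⟨hp⟩
  haveI : Algebra.IsAlgebraic (ZMod p) (AlgebraicClosure F) :=
    Algebra.IsAlgebraic.trans (ZMod p) F (AlgebraicClosure F)
  have hw' : ∀ m, Edge p P Q (AlgebraicClosure F) (algebraMap F (AlgebraicClosure F) ∘ wF m)
      (algebraMap F (AlgebraicClosure F) ∘ wF (m + 1)) :=
    fun m => Edge.map_algebraMap P Q (hwF m)
  have h0 : wF r = wF 0 := by simpa using hper 0
  have hcr : decode n (AlgebraicClosure F) e ((algebraMap F (AlgebraicClosure F) ∘ wF r) ∘ Fin.castAdd M) =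
      decode n (AlgebraicClosure F) e ((algebraMap F (AlgebraicClosure F) ∘ wF 0) ∘ Fin.castAdd M) := by
    rw [h0]
  obtain ⟨d₀, i', t', r', hr', hgood, hiso⟩ :=
    hU hKit hTr hLo p hp n hn β (AlgebraicClosure F)
      (fun m => decode n (AlgebraicClosure F) e
        ((algebraMap F (AlgebraicClosure F) ∘ wF m) ∘ Fin.castAdd M)) r hr hcr
      (fun m _ => hdec (AlgebraicClosure F) _ _ (hw' m))
  exact noPeriodicIsolatedAtom_iff.1 hNP p hp n hn (AlgebraicClosure F) d₀ i' t' r' hr' hgood hiso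

/-- **The crux `ClosingReduction` of route `FrobeniusClosing`, assembled from the seven landed stubs of
line `chart-factorization`, conditional only on the route's support item `ClosingLemma`
(stmt-ResolutionOfSingularities-16348).** -/
theorem ClosingReduction_proof (hCL : ClosingLemma) : ClosingReduction :=
  ClosingReduction_of stub_pairIsoKit stub_transport stub_determinacy stub_loewyKit stub_arena
    stub_unwinding stub_thm21BGM hCL

end Summit.ResolutionOfSingularities.ResolutionOfSingularities.Theorems.FrobeniusClosing

end
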